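import Literature.Probability.RandomPlanarGeometry.HexSAWSurfaceWallRenewalSixStepRigid
import HarnessLib

/-!
# Slack two in the six-step law: the families F2a, F2b, F2c, F3L, F3R — `2 + Σ_{j<k} j²` irreducible blocks of length `6k + 2` with `k` visits

For the self-avoiding walk on the honeycomb lattice (brick-wall frame) in the half-plane `Y ≤ 0`, the six-step law
`six_mul_visits_le` (`HexSAWSurfaceWallRenewalSixStep`) bounds the surface visits `v = visits n ω` of an IRREDUCIBLE POSITIVE
WALL BRIDGE `ω ∈ ipwb n` (`n ≥ 4`) by `6v ≤ n`, and `HexSAWSurfaceWallRenewalSixStepRigid` decides the equality case (SLACK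
`n − 6v = 0`: the hook staircases `H_k`, one per length `6k`; census `N_{3k,k} = 1`).  This module treats the next diagonal of
the irreducible two-variable census `N_{s,v} := #{ω ∈ ipwb (2s) : visits = v}`, SLACK TWO (`n = 6k + 2`, `v = k`), from the
constructive side: it exhibits, for every `k ≥ 2`, `2 + Σ_{j<k} j² = 2 + (k−1)k(2k−1)/6` DISTINCT irreducible positive wall
bridges of length `6k + 2` with exactly `k` visits, in five explicit families typed as table walks with symbolic
parameters (`Tab.walk`, `Tab.Facts` of `HexSAWSurfaceFourthOrderLower`), and proves the census lower bound

* `two_add_sum_sq_le_card_filter_visits : 2 ≤ k → m = 6 * k + 2 → 2 + ∑ j ∈ range k, j ^ 2 ≤ #((ipwb m).filter fun ω => visits m ω = k)`,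
  in closed form `closed_form_le_six_mul_card_filter_visits : 12 + (k − 1) k (2k − 1) ≤ 6 · N_{3k+1,k}`;
* `slackTwoBlocks k` (the Finset of all blocks of the five families), `slackTwoBlocks_subset` (each is in `ipwb (6k+2)` with
  `k` visits) and `card_slackTwoBlocks : #(slackTwoBlocks k) = 2 + ∑ j ∈ range k, j ^ 2` (`3, 7, 16, 32, 57, 93, …`);
* per family (`f2a k a`, `f2bc k j`, `f3l k a b c`, `f3r k b c`): the coordinate facts (`*_facts : Tab.Facts (6k+2) …`),
  membership `*_mem_pwb`, irreducibility `*_mem_ipwb`, the visit count `visits_* = k`, all with the length symbolic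
  (`hm : m = 6 * k + 2`), and the injectivity / disjointness of the parametrisations (§5);
* §0 two reusable tools: `mem_ipwb_of_facts_wit` (a table walk is irreducible once every interior wall time carries a
  NON-RENEWAL WITNESS — a later time in a column `≤ X_t` or an earlier time in a column `> X_t`; this extends
  `mem_ipwb_of_facts` of `HexSAWSurfaceWallRenewalTenThree`, which needs NO interior wall time) and `visits_add_of_wall`
  (visits along a wall segment are its even times).

THE FIVE FAMILIES (step words; `R/L` = horizontal steps, `D/U` = vertical steps; `hairpin(a) = R^{2a+1} D L^{2a−1} D`; the
vertical-step profile is `D D U U` for F2 and `D D D U U U` for F3; every block starts `(0,0)` and ends on the wall):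
* F2a (`1 ≤ a ≤ k−1`; `k − 1` blocks): `hairpin(a) R^{2k} U L^{2k−2a−1} U R^{2k−2a−1}`, end `(2k+2, 0)` — the hook's hairpin
  opened at `a < k − 1` wall visits and closed by a LEFTWARD return run on row `−1` (`a` visits first, `k − a` last);
* F2b, F2c (`j = 1, 0`; 2 blocks): `hairpin(k−1) R^{2k−2+2j} U R^{3−2j} U R`, end `(2k+4, 0)` — the hook `H_k` with its
  exit stretched by two columns (bottom run two longer, or row `−1` run two longer);
* F3L (`1 ≤ a`, `1 ≤ c`, `a + c ≤ k−1`, `0 ≤ b ≤ k−1−c`; `Σ_{w=1}^{k−2} w(w+1)` blocks):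
  `hairpin(a) R^{2b+1} D R^{2k−2−2b} U L^{2c−1} U L^{2k−2a−2c−1} U R^{2k−2a−1}`, end `(2k+2, 0)` — a dive to row `−3` after
  `2b+1` bottom steps, leftward returns on rows `−2` and `−1`;
* F3R (`1 ≤ c`, `0 ≤ b ≤ k−2−c`; `(k−2)(k−1)/2` blocks): `hairpin(k−1) R^{2b+1} D R^{2c} U R^{2k−3−2b−2c} U R U R`, end
  `(2k+2, 0)` — the hook with a row `−3` excursion of length `2c` inside its bottom run.
Count: `(k−1) + 2 + Σ_{w<k−1} w(w+1) + Σ_{w<k−2} (w+1) = 2 + Σ_{j<k} j²` (`slackTwo_count`, increment `k²`).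

PROOF MAP.  Each family is a pair of column/height tables `ℕ → ℕ → … → ℤ` by cases on 5 (F2) or 7 (F3) affine pieces with
`ℕ`-subtraction-free conditions (§1–§4: `*_cases` lists the pieces with their values; `Tab.Facts` = brick-wall adjacency of
consecutive times, injectivity of `(X, Y)` on `[0, 6k+2]`, `Y ≤ 0`, `0 ≤ X ≤ X_{6k+2}`, `X ≥ 1` after time `0`, wall at both
ends — each clause is linear arithmetic on a pair of pieces).  Membership in `pwb` is `mem_pwb_of_facts`; irreducibility is
`mem_ipwb_of_facts_wit` with the witnesses: an interior visit `t` of the initial wall run is followed by the return to column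
`2 ≤ t` (time `4a+1`, resp. `4k−3`), and an interior visit of the final wall run of F2a/F3L is preceded by the far end
`2k+2` (resp. `2k+1`) `> X_t` of the bottom (resp. row `−3`) run; `visits = k` by `visits_add_of_wall` on the two wall runs and
`visits_add_eq_left` (`HexSAWSurfaceWallBridges`) strictly below the wall in between.  §5 separates the blocks by their row
or column at one discriminating time each (`a` at time `2a+2`, `b` at `4a+2b+4` / `4k+2b`, `c` at `4a+2k+2c+3` / `4k+2b+2c+1`,
`j` at `6k−3`; F2b/F2c end in column `2k+4`, the others in `2k+2`; F3 blocks reach row `−3`, F2a never; F3L leaves the wall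
at time `2a+2 ≤ 2k−2`, F3R at `2k`), §6 assembles the Finset (images of `range`/`sigma` index sets, `card_image_of_injOn`,
`card_union_of_disjoint`, `card_sigma`) and §7 is `card_le_card`.

SOURCES AND STATUS.  The objects are those of Madras–Slade [MadrasSlade1993, §1.2 Definition 1.2.4 (bridges), §4.2
Definition 4.2.1 and (4.2.2) (renewal times, irreducible bridges, their generating function)] and Kesten [Kesten1963SAW, §4]
transported to wall bridges of the adsorbing honeycomb walk in the brick-wall frame of Enting–Jensen [EntingJensen2009,
§7.4.2, Fig. 7.10], with the surface-visit statistic of [BeatonBousquetMelouDeGierDuminilCopinGuttmann2014, §3.1].  OURS (new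
in writing, modest): the five families, their irreducibility and the census lower bound `N_{3k+1,k} ≥ 2 + (k−1)k(2k−1)/6` are
computed in this lane — the value `2 + (k−1)k(2k−1)/6` was observed on the lane's enumeration of `ipwb n`, `n ≤ 32`
(`N_{7,2} = 3`, `N_{10,3} = 7`, `N_{13,4} = 16`, `N_{16,5} = 32`, where it is an EQUALITY) and the families were read off
that data; none of the cited sources states them (they supply the model, the renewal structure and the frame only).
NOT CLAIMED here: the reverse inclusion `(ipwb (6k+2)).filter (visits = k) ⊆ slackTwoBlocks k`, i.e. the slack-two RIGIDITY
`N_{3k+1,k} = 2 + (k−1)k(2k−1)/6` for all `k` (equality is data for `k ≤ 5` only); the case `k = 1` (`ipwb 8` is a single block,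
`card_ipwb_eight_eq_one` of `HexSAWSurfaceWallRenewalEightUnique`); any generating-function or critical-window consequence.
-/


namespace Literature.Probability.RandomPlanarGeometry.SAW.HexBW.Wall

open Finset Filter Function
open Literature.Probability.LatticeModels Literature.Probability.Percolation SimpleGraph

variable {n : ℕ} {ω : ℕ → Site 2}

/-! ### §0  Table walks: irreducibility from witnesses, visits along a wall segment -/

/-- The Boolean adjacency test `Eight.adjE` read as a proposition. [cite: EntingJensen2009, §7.4.2, Fig. 7.10 (brickwork form of the honeycomb lattice)] -/
private theorem adjE_iff_st {a b c d : ℤ} : Eight.adjE a b c d = true ↔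
    ((c = a + 1 ∨ a = c + 1) ∧ d = b) ∨ (c = a ∧ ((d = b + 1 ∧ (a + b) % 2 = 0) ∨ (b = d + 1 ∧ (c + d) % 2 = 0))) := by
  simp [Eight.adjE]

/-- A table walk is an IRREDUCIBLE positive wall bridge as soon as every interior wall time `t` (even, `1 ≤ t < L`,
`Y_t = 0`) carries a NON-RENEWAL WITNESS: a later time `j ≤ L` back in a column `X_j ≤ X_t` (the tail is not a bridge) or
an earlier time `1 ≤ i < t` in a column `X_i > X_t` (the head is not a bridge).  Length and walk symbolic.
[cite: MadrasSlade1993, §4.2, Definition 4.2.1 (renewal times, irreducible bridges)] [cite: Kesten1963SAW, §4] -/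
theorem mem_ipwb_of_facts_wit {L m : ℕ} {X Y : ℕ → ℤ} {w : ℕ → Site 2} (hw : w = Tab.walk L X Y) (h : Tab.Facts L X Y)
    (hm : m = L) (hL : 1 ≤ L)
    (hwit : ∀ t, 1 ≤ t → t < L → t % 2 = 0 → Y t = 0 →
      (∃ j, t < j ∧ j ≤ L ∧ X j ≤ X t) ∨ (∃ i, 1 ≤ i ∧ i < t ∧ X t < X i)) :
    w ∈ ipwb m := by
  rw [mem_ipwb]
  refine ⟨mem_pwb_of_facts hw h hm, by omega, fun t ht1 ht2 hren => ?_⟩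
  obtain ⟨⟨-, hhead, htail⟩, hte, hY⟩ := hren
  subst hm hw
  rw [Tab.walk_apply_of_le ht2.le, Arm.pt_apply_one] at hY
  rcases hwit t ht1 ht2 hte hY with ⟨j, htj, hjL, hX⟩ | ⟨i, hi1, hit, hX⟩
  · have h1 := (htail (j - t) (by omega) (by omega)).1
    simp only [Nat.add_zero] at h1
    rw [show t + (j - t) = j by omega, Tab.walk_apply_of_le hjL, Tab.walk_apply_of_le ht2.le, Arm.pt_apply_zero,
      Arm.pt_apply_zero] at h1
    omega
  · have h1 := (hhead i hi1 hit.le).2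
    rw [Tab.walk_apply_of_le (hit.trans ht2).le, Tab.walk_apply_of_le ht2.le, Arm.pt_apply_zero,
      Arm.pt_apply_zero] at h1
    omega

/-- Visits along a WALL SEGMENT: if `Y = 0` at the times `m + 1, …, m + b`, the visits in `(m, m + b]` are its even times,
`(m + b)/2 − m/2` of them. [cite: BeatonBousquetMelouDeGierDuminilCopinGuttmann2014, §3.1 (arXiv v5 p. 8: surface contacts)] -/
theorem visits_add_of_wall {m b : ℕ} {ζ : ℕ → Site 2} (h : ∀ j, 1 ≤ j → j ≤ b → ζ (m + j) 1 = 0) :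
    visits (m + b) ζ = visits m ζ + ((m + b) / 2 - m / 2) := by
  induction b with
  | zero => simp
  | succ b ih =>
    have e := h (b + 1) (by omega) le_rfl
    rw [← add_assoc] at e
    rw [← add_assoc, visits_succ, ih (fun j h1 hj => h j h1 (by omega))]
    by_cases hp : (m + b + 1) % 2 = 0
    · rw [if_pos ⟨hp, e⟩]; omega
    · rw [if_neg (fun h' => hp h'.1)]; omega

/-- Coordinates of a table walk up to its length. [cite: EntingJensen2009, §7.4.2, Fig. 7.10] -/
theorem tab_walk_apply {L : ℕ} {X Y : ℕ → ℤ} {i : ℕ} (hi : i ≤ L) :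
    Tab.walk L X Y i 0 = X i ∧ Tab.walk L X Y i 1 = Y i := by
  rw [Tab.walk_apply_of_le hi, Arm.pt_apply_zero, Arm.pt_apply_one]; exact ⟨rfl, rfl⟩

/-! ### §1  Family F2a: `hairpin(a) · R^{2k} U L^{2k−2a−1} U R^{2k−2a−1}` (`1 ≤ a ≤ k − 1`), profile `D D U U`, `X_n = 2k + 2` -/

/-- Column table of the F2a block with hairpin parameter `a` (`1 ≤ a ≤ k−1`, length `6k+2`): wall run `(i,0)`, `i ≤ 2a+1`;
return run `(4a+3−i, −1)` back to column `2`; bottom run `(i−4a, −2)` out to column `2k+2`; return run `(4a+4k+5−i, −1)`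
back to column `2a+3`; final wall run `(i−4k, 0)` out to `2k+2`. [cite: EntingJensen2009, §7.4.2, Fig. 7.10 (brickwork form of the honeycomb lattice)] -/
def f2aX (k a i : ℕ) : ℤ :=
  if i ≤ 2 * a + 1 then (i : ℤ)
  else if i ≤ 4 * a + 1 then 4 * (a : ℤ) + 3 - i
  else if i ≤ 4 * a + 2 * k + 2 then (i : ℤ) - 4 * a
  else if i ≤ 2 * a + 4 * k + 2 then 4 * (a : ℤ) + 4 * k + 5 - i
  else (i : ℤ) - 4 * k

/-- Height table of the F2a block. [cite: EntingJensen2009, §7.4.2, Fig. 7.10] -/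
def f2aY (k a i : ℕ) : ℤ :=
  if i ≤ 2 * a + 1 then 0
  else if i ≤ 4 * a + 1 then -1
  else if i ≤ 4 * a + 2 * k + 2 then -2
  else if i ≤ 2 * a + 4 * k + 2 then -1
  else 0

/-- **The F2a block** `(0,0)→…→(2a+1,0)↓←…←(2,−1)↓(2,−2)→…→(2k+2,−2)↑(2k+2,−1)←…←(2a+3,−1)↑(2a+3,0)→…→(2k+2,0)` of
length `6k+2` (`1 ≤ a ≤ k−1`). [cite: EntingJensen2009, §7.4.2, Fig. 7.10] -/
def f2a (k a : ℕ) : ℕ → Site 2 := Tab.walk (6 * k + 2) (f2aX k a) (f2aY k a)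


/-- The five affine pieces of the F2a tables, with their values. [cite: EntingJensen2009, §7.4.2, Fig. 7.10] -/
private theorem f2a_cases (k a i : ℕ) :
    (i ≤ 2 * a + 1 ∧ f2aX k a i = i ∧ f2aY k a i = 0) ∨
      (2 * a + 2 ≤ i ∧ i ≤ 4 * a + 1 ∧ f2aX k a i = 4 * (a : ℤ) + 3 - i ∧ f2aY k a i = -1) ∨
      (4 * a + 2 ≤ i ∧ i ≤ 4 * a + 2 * k + 2 ∧ f2aX k a i = (i : ℤ) - 4 * a ∧ f2aY k a i = -2) ∨
      (4 * a + 2 * k + 3 ≤ i ∧ i ≤ 2 * a + 4 * k + 2 ∧ f2aX k a i = 4 * (a : ℤ) + 4 * k + 5 - i ∧ f2aY k a i = -1) ∨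
      (2 * a + 4 * k + 3 ≤ i ∧ f2aX k a i = (i : ℤ) - 4 * k ∧ f2aY k a i = 0) := by
  simp only [f2aX, f2aY]
  split_ifs <;> omega

/-- **Coordinate facts of the F2a block** (`1 ≤ a ≤ k − 1`): brick-wall steps, self-avoidance, lower half-plane, columns in
`[0, 2k+2]` and `≥ 1` after time `0`, start and end on the wall, even length.  All clauses on the five affine pieces.
[cite: EntingJensen2009, §7.4.2, Fig. 7.10] [cite: MadrasSlade1993, §1.2, Definition 1.2.4 (bridges)] -/
theorem f2a_facts {k a : ℕ} (ha : 1 ≤ a) (hak : a + 1 ≤ k) : Tab.Facts (6 * k + 2) (f2aX k a) (f2aY k a) := by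
  refine ⟨fun i hi => ?_, fun i hi j hj hx hy => ?_, fun i hi => ?_, fun i hi => ?_, ?_, ?_, ?_, by omega, fun i hi h1 => ?_⟩
  · rw [adjE_iff_st]
    rcases f2a_cases k a i with ⟨x1, x, y⟩ | ⟨x1, x2, x, y⟩ | ⟨x1, x2, x, y⟩ | ⟨x1, x2, x, y⟩ | ⟨x1, x, y⟩ <;>
      rcases f2a_cases k a (i + 1) with ⟨x1', x', y'⟩ | ⟨x1', x2', x', y'⟩ | ⟨x1', x2', x', y'⟩ | ⟨x1', x2', x', y'⟩ |
        ⟨x1', x', y'⟩ <;> omega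
  · rcases f2a_cases k a i with ⟨x1, x, y⟩ | ⟨x1, x2, x, y⟩ | ⟨x1, x2, x, y⟩ | ⟨x1, x2, x, y⟩ | ⟨x1, x, y⟩ <;>
      rcases f2a_cases k a j with ⟨z1, z, u⟩ | ⟨z1, z2, z, u⟩ | ⟨z1, z2, z, u⟩ | ⟨z1, z2, z, u⟩ | ⟨z1, z, u⟩ <;> omega
  · rcases f2a_cases k a i with ⟨x1, x, y⟩ | ⟨x1, x2, x, y⟩ | ⟨x1, x2, x, y⟩ | ⟨x1, x2, x, y⟩ | ⟨x1, x, y⟩ <;> omega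
  · have h0 := f2a_cases k a 0
    have hL := f2a_cases k a (6 * k + 2)
    rcases f2a_cases k a i with ⟨x1, x, y⟩ | ⟨x1, x2, x, y⟩ | ⟨x1, x2, x, y⟩ | ⟨x1, x2, x, y⟩ | ⟨x1, x, y⟩ <;> omega
  · have h0 := f2a_cases k a 0; omega
  · have h0 := f2a_cases k a 0; omega
  · have hL := f2a_cases k a (6 * k + 2); omega
  · rcases f2a_cases k a i with ⟨x1, x, y⟩ | ⟨x1, x2, x, y⟩ | ⟨x1, x2, x, y⟩ | ⟨x1, x2, x, y⟩ | ⟨x1, x, y⟩ <;> omega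

/-- The F2a block is a positive wall bridge of length `m = 6k + 2` (length symbolic).
[cite: MadrasSlade1993, §1.2, Definition 1.2.4] [cite: EntingJensen2009, §7.4.2, Fig. 7.10] -/
theorem f2a_mem_pwb {k a m : ℕ} (ha : 1 ≤ a) (hak : a + 1 ≤ k) (hm : m = 6 * k + 2) : f2a k a ∈ pwb m :=
  mem_pwb_of_facts rfl (f2a_facts ha hak) hm

/-- Coordinates of the F2a block up to its length. [cite: EntingJensen2009, §7.4.2, Fig. 7.10] -/
theorem f2a_apply {k a i : ℕ} (hi : i ≤ 6 * k + 2) : f2a k a i 0 = f2aX k a i ∧ f2a k a i 1 = f2aY k a i :=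
  tab_walk_apply hi

/-- **The F2a block is irreducible**: `f2a k a ∈ ipwb (6k+2)`.  The interior visits of the initial wall run (times `t ≤ 2a`)
are no renewal times because the walk is back in column `2 ≤ t` at time `4a + 1`; those of the final wall run (times
`t ≥ 2a+4k+4`) because the bottom run reached column `2k + 2 > X_t` at the earlier time `4a + 2k + 2`.
[cite: MadrasSlade1993, §4.2, Definition 4.2.1] [cite: Kesten1963SAW, §4] [cite: EntingJensen2009, §7.4.2, Fig. 7.10] -/
theorem f2a_mem_ipwb {k a m : ℕ} (ha : 1 ≤ a) (hak : a + 1 ≤ k) (hm : m = 6 * k + 2) : f2a k a ∈ ipwb m := by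
  refine mem_ipwb_of_facts_wit rfl (f2a_facts ha hak) hm (by omega) fun t ht1 ht2 hte hY => ?_
  rcases f2a_cases k a t with ⟨x1, x, y⟩ | ⟨x1, x2, x, y⟩ | ⟨x1, x2, x, y⟩ | ⟨x1, x2, x, y⟩ | ⟨x1, x, y⟩
  · refine Or.inl ⟨4 * a + 1, by omega, by omega, ?_⟩
    rcases f2a_cases k a (4 * a + 1) with ⟨z1, z, u⟩ | ⟨z1, z2, z, u⟩ | ⟨z1, z2, z, u⟩ | ⟨z1, z2, z, u⟩ | ⟨z1, z, u⟩ <;> omega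
  · omega
  · omega
  · omega
  · refine Or.inr ⟨4 * a + 2 * k + 2, by omega, by omega, ?_⟩
    rcases f2a_cases k a (4 * a + 2 * k + 2) with ⟨z1, z, u⟩ | ⟨z1, z2, z, u⟩ | ⟨z1, z2, z, u⟩ | ⟨z1, z2, z, u⟩ |
      ⟨z1, z, u⟩ <;> omega

/-- **The F2a block has `k` visits** (`a` on the initial wall run at the times `2, …, 2a`, and `k − a` on the final wall run).
[cite: BeatonBousquetMelouDeGierDuminilCopinGuttmann2014, §3.1 (arXiv v5 p. 8)] [cite: EntingJensen2009, §7.4.2, Fig. 7.10] -/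
theorem visits_f2a {k a m : ℕ} (ha : 1 ≤ a) (hak : a + 1 ≤ k) (hm : m = 6 * k + 2) : visits m (f2a k a) = k := by
  have hY : ∀ i, i ≤ 6 * k + 2 → f2a k a i 1 = f2aY k a i := fun i hi => (f2a_apply hi).2
  have h1 : visits (0 + (2 * a + 1)) (f2a k a) = visits 0 (f2a k a) + ((0 + (2 * a + 1)) / 2 - 0 / 2) :=
    visits_add_of_wall fun j _ hj => by
      rw [hY _ (by omega)]
      rcases f2a_cases k a (0 + j) with ⟨z1, z, u⟩ | ⟨z1, z2, z, u⟩ | ⟨z1, z2, z, u⟩ | ⟨z1, z2, z, u⟩ | ⟨z1, z, u⟩ <;> omega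
  have h2 : visits (2 * a + 1 + (4 * k + 1)) (f2a k a) = visits (2 * a + 1) (f2a k a) :=
    visits_add_eq_left fun j hj1 hj2 h => by
      obtain ⟨-, h0⟩ := h
      rw [hY _ (by omega)] at h0
      rcases f2a_cases k a (2 * a + 1 + j) with ⟨z1, z, u⟩ | ⟨z1, z2, z, u⟩ | ⟨z1, z2, z, u⟩ | ⟨z1, z2, z, u⟩ |
        ⟨z1, z, u⟩ <;> omega
  have h3 : visits (2 * a + 4 * k + 2 + (2 * k - 2 * a)) (f2a k a) =
      visits (2 * a + 4 * k + 2) (f2a k a) + ((2 * a + 4 * k + 2 + (2 * k - 2 * a)) / 2 - (2 * a + 4 * k + 2) / 2) :=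
    visits_add_of_wall fun j _ hj => by
      rw [hY _ (by omega)]
      rcases f2a_cases k a (2 * a + 4 * k + 2 + j) with ⟨z1, z, u⟩ | ⟨z1, z2, z, u⟩ | ⟨z1, z2, z, u⟩ | ⟨z1, z2, z, u⟩ |
        ⟨z1, z, u⟩ <;> omega
  rw [zero_add, visits_zero, zero_add] at h1
  rw [show 2 * a + 1 + (4 * k + 1) = 2 * a + 4 * k + 2 by omega, h1] at h2
  rw [show 2 * a + 4 * k + 2 + (2 * k - 2 * a) = 6 * k + 2 by omega, h2] at h3
  subst hm
  rw [h3]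
  omega

/-! ### §2  Families F2b (`j = 1`) and F2c (`j = 0`): `hairpin(k−1) · R^{2k−2+2j} U R^{3−2j} U R`, profile `D D U U`, `X_n = 2k + 4` -/

/-- Column table of the two `X_n = 2k+4` stretchings of the hook staircase `H_k` (`k ≥ 2`, `j ∈ {0,1}`, length `6k+2`): wall run `(t,0)`, `t ≤ 2k−1`; return run `(4k−1−t,−1)` back to column `2`; bottom run `(t+4−4k,−2)` out to column `2k+2j`; row `−1` exit run `(t+3−4k,−1)` to column `2k+3`; wall step to `(2k+4,0)`. [cite: EntingJensen2009, §7.4.2, Fig. 7.10 (brickwork form of the honeycomb lattice)] -/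
def f2bcX (k j t : ℕ) : ℤ :=
  if t + 1 ≤ 2 * k then (t : ℤ)
  else if t + 3 ≤ 4 * k then 4 * (k : ℤ) - 1 - t
  else if t + 4 ≤ 6 * k + 2 * j then (t : ℤ) + 4 - 4 * k
  else if t ≤ 6 * k then (t : ℤ) + 3 - 4 * k
  else (t : ℤ) + 2 - 4 * k

/-- Height table of the F2b/F2c blocks. [cite: EntingJensen2009, §7.4.2, Fig. 7.10] -/
def f2bcY (k j t : ℕ) : ℤ :=
  if t + 1 ≤ 2 * k then 0
  else if t + 3 ≤ 4 * k then -1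
  else if t + 4 ≤ 6 * k + 2 * j then -2
  else if t ≤ 6 * k then -1
  else 0

/-- **The F2b (`j = 1`) / F2c (`j = 0`) block** `hairpin(k−1) R^{2k−2+2j} U R^{3−2j} U R` of length `6k+2`, ending at `(2k+4, 0)`. [cite: EntingJensen2009, §7.4.2, Fig. 7.10] -/
def f2bc (k j : ℕ) : ℕ → Site 2 := Tab.walk (6 * k + 2) (f2bcX k j) (f2bcY k j)

/-- The 5 affine pieces of the F2b/F2c tables, with their values. [cite: EntingJensen2009, §7.4.2, Fig. 7.10] -/
private theorem f2bc_cases (k j t : ℕ) :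
    (t + 1 ≤ 2 * k ∧ f2bcX k j t = (t : ℤ) ∧ f2bcY k j t = 0) ∨
      (2 * k ≤ t ∧ t + 3 ≤ 4 * k ∧ f2bcX k j t = 4 * (k : ℤ) - 1 - t ∧ f2bcY k j t = -1) ∨
      (4 * k ≤ t + 2 ∧ t + 4 ≤ 6 * k + 2 * j ∧ f2bcX k j t = (t : ℤ) + 4 - 4 * k ∧ f2bcY k j t = -2) ∨
      (6 * k + 2 * j ≤ t + 3 ∧ t ≤ 6 * k ∧ f2bcX k j t = (t : ℤ) + 3 - 4 * k ∧ f2bcY k j t = -1) ∨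
      (6 * k + 1 ≤ t ∧ f2bcX k j t = (t : ℤ) + 2 - 4 * k ∧ f2bcY k j t = 0) := by
  simp only [f2bcX, f2bcY]
  split_ifs <;> omega

/-- **Coordinate facts of the F2b/F2c block**: brick-wall steps, self-avoidance, lower half-plane, columns in
`[0, X_n]` and `≥ 1` after time `0`, start and end on the wall, even length — all on the affine pieces.
[cite: EntingJensen2009, §7.4.2, Fig. 7.10] [cite: MadrasSlade1993, §1.2, Definition 1.2.4 (bridges)] -/
theorem f2bc_facts {k j : ℕ} (hk : 2 ≤ k) (hj : j ≤ 1) : Tab.Facts (6 * k + 2) (f2bcX k j) (f2bcY k j) := by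
  refine ⟨fun t ht => ?_, fun t ht s hs hx hy => ?_, fun t ht => ?_, fun t ht => ?_, ?_, ?_, ?_, by omega, fun t ht h1 => ?_⟩
  · rw [adjE_iff_st]
    rcases f2bc_cases k j t with ⟨h, x, y⟩ | ⟨l, h, x, y⟩ | ⟨l, h, x, y⟩ | ⟨l, h, x, y⟩ | ⟨l, x, y⟩ <;>
      rcases f2bc_cases k j (t + 1) with ⟨h', x', y'⟩ | ⟨l', h', x', y'⟩ | ⟨l', h', x', y'⟩ | ⟨l', h', x', y'⟩ | ⟨l', x', y'⟩ <;> omega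
  · rcases f2bc_cases k j t with ⟨h, x, y⟩ | ⟨l, h, x, y⟩ | ⟨l, h, x, y⟩ | ⟨l, h, x, y⟩ | ⟨l, x, y⟩ <;>
      rcases f2bc_cases k j s with ⟨h', x', y'⟩ | ⟨l', h', x', y'⟩ | ⟨l', h', x', y'⟩ | ⟨l', h', x', y'⟩ | ⟨l', x', y'⟩ <;> omega
  · rcases f2bc_cases k j t with ⟨h, x, y⟩ | ⟨l, h, x, y⟩ | ⟨l, h, x, y⟩ | ⟨l, h, x, y⟩ | ⟨l, x, y⟩ <;> omega
  · have h0 := f2bc_cases k j 0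
    have hL := f2bc_cases k j (6 * k + 2)
    rcases f2bc_cases k j t with ⟨h, x, y⟩ | ⟨l, h, x, y⟩ | ⟨l, h, x, y⟩ | ⟨l, h, x, y⟩ | ⟨l, x, y⟩ <;> omega
  · have h0 := f2bc_cases k j 0; omega
  · have h0 := f2bc_cases k j 0; omega
  · have hL := f2bc_cases k j (6 * k + 2); omega
  · rcases f2bc_cases k j t with ⟨h, x, y⟩ | ⟨l, h, x, y⟩ | ⟨l, h, x, y⟩ | ⟨l, h, x, y⟩ | ⟨l, x, y⟩ <;> omega

/-- The F2b/F2c block is a positive wall bridge of length `m = 6k + 2` (length symbolic).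
[cite: MadrasSlade1993, §1.2, Definition 1.2.4] [cite: EntingJensen2009, §7.4.2, Fig. 7.10] -/
theorem f2bc_mem_pwb {k j m : ℕ} (hk : 2 ≤ k) (hj : j ≤ 1) (hm : m = 6 * k + 2) : f2bc k j ∈ pwb m :=
  mem_pwb_of_facts rfl (f2bc_facts hk hj) hm

/-- Coordinates of the F2b/F2c block up to its length. [cite: EntingJensen2009, §7.4.2, Fig. 7.10] -/
theorem f2bc_apply {k j t : ℕ} (ht : t ≤ 6 * k + 2) : f2bc k j t 0 = f2bcX k j t ∧ f2bc k j t 1 = f2bcY k j t :=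
  tab_walk_apply ht

/-- **The F2b/F2c block is irreducible** (length symbolic): the interior visits (times `t ≤ 2k−2` of the wall run) are no renewal times because the walk is back in column `2 ≤ t` at time `4k−3`.
[cite: MadrasSlade1993, §4.2, Definition 4.2.1] [cite: Kesten1963SAW, §4] [cite: EntingJensen2009, §7.4.2, Fig. 7.10] -/
theorem f2bc_mem_ipwb {k j m : ℕ} (hk : 2 ≤ k) (hj : j ≤ 1) (hm : m = 6 * k + 2) : f2bc k j ∈ ipwb m := by
  refine mem_ipwb_of_facts_wit rfl (f2bc_facts hk hj) hm (by omega) fun t ht1 ht2 hte hY => ?_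
  rcases f2bc_cases k j t with ⟨h, x, y⟩ | ⟨l, h, x, y⟩ | ⟨l, h, x, y⟩ | ⟨l, h, x, y⟩ | ⟨l, x, y⟩
  · refine Or.inl ⟨4 * k - 3, by omega, by omega, ?_⟩
    rcases f2bc_cases k j (4 * k - 3) with ⟨h', x', y'⟩ | ⟨l', h', x', y'⟩ | ⟨l', h', x', y'⟩ | ⟨l', h', x', y'⟩ | ⟨l', x', y'⟩ <;> omega
  · omega
  · omega
  · omega
  · omega

/-- **The F2b/F2c block has `k` visits**: `k − 1` on the initial wall run and the endpoint.
[cite: BeatonBousquetMelouDeGierDuminilCopinGuttmann2014, §3.1 (arXiv v5 p. 8)] [cite: EntingJensen2009, §7.4.2, Fig. 7.10] -/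
theorem visits_f2bc {k j m : ℕ} (hk : 2 ≤ k) (hj : j ≤ 1) (hm : m = 6 * k + 2) : visits m (f2bc k j) = k := by
  have hY : ∀ t, t ≤ 6 * k + 2 → f2bc k j t 1 = f2bcY k j t := fun t ht => (f2bc_apply ht).2
  have h1 : visits (0 + (2 * k - 1)) (f2bc k j) = visits (0) (f2bc k j) + ((0 + (2 * k - 1)) / 2 - (0) / 2) :=
    visits_add_of_wall fun q _ hq => by
      rw [hY _ (by omega)]
      rcases f2bc_cases k j (0 + q) with ⟨h', x', y'⟩ | ⟨l', h', x', y'⟩ | ⟨l', h', x', y'⟩ | ⟨l', h', x', y'⟩ | ⟨l', x', y'⟩ <;> omega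
  have h2 : visits (2 * k - 1 + (4 * k + 1)) (f2bc k j) = visits (2 * k - 1) (f2bc k j) :=
    visits_add_eq_left fun q hq1 hq2 h => by
      obtain ⟨-, h0⟩ := h
      rw [hY _ (by omega)] at h0
      rcases f2bc_cases k j (2 * k - 1 + q) with ⟨h', x', y'⟩ | ⟨l', h', x', y'⟩ | ⟨l', h', x', y'⟩ | ⟨l', h', x', y'⟩ | ⟨l', x', y'⟩ <;> omega
  have h3 : visits (6 * k + (2)) (f2bc k j) = visits (6 * k) (f2bc k j) + ((6 * k + (2)) / 2 - (6 * k) / 2) :=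
    visits_add_of_wall fun q _ hq => by
      rw [hY _ (by omega)]
      rcases f2bc_cases k j (6 * k + q) with ⟨h', x', y'⟩ | ⟨l', h', x', y'⟩ | ⟨l', h', x', y'⟩ | ⟨l', h', x', y'⟩ | ⟨l', x', y'⟩ <;> omega
  rw [zero_add, visits_zero, zero_add] at h1
  rw [show 2 * k - 1 + (4 * k + 1) = 6 * k by omega, h1] at h2
  rw [show 6 * k + (2) = 6 * k + 2 by omega, h2] at h3
  subst hm
  rw [h3]
  omega

/-! ### §3  Family F3L: `hairpin(a) · R^{2b+1} D R^{2k−2−2b} U L^{2c−1} U L^{2k−2a−2c−1} U R^{2k−2a−1}`, profile `D D D U U U`, `X_n = 2k + 2` -/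

/-- Column table of the F3L block (`1 ≤ a`, `1 ≤ c`, `a + c ≤ k−1`, `b + c ≤ k−1`; length `6k+2`): wall run `(t,0)`, `t ≤ 2a+1`; return run `(4a+3−t,−1)` to column `2`; row `−2` run `(t−4a,−2)` to column `2b+3`; row `−3` run `(t−4a−1,−3)` to column `2k+1`; row `−2` return `(4a+4k+4−t,−2)` to column `2k+2−2c`; row `−1` return `(4a+4k+5−t,−1)` to column `2a+3`; final wall run `(t−4k,0)` to `2k+2`. [cite: EntingJensen2009, §7.4.2, Fig. 7.10 (brickwork form of the honeycomb lattice)] -/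
def f3lX (k a b c t : ℕ) : ℤ :=
  if t ≤ 2 * a + 1 then (t : ℤ)
  else if t ≤ 4 * a + 1 then 4 * (a : ℤ) + 3 - t
  else if t ≤ 4 * a + 2 * b + 3 then (t : ℤ) - 4 * a
  else if t ≤ 4 * a + 2 * k + 2 then (t : ℤ) - 4 * a - 1
  else if t ≤ 4 * a + 2 * k + 2 * c + 2 then 4 * (a : ℤ) + 4 * k + 4 - t
  else if t ≤ 2 * a + 4 * k + 2 then 4 * (a : ℤ) + 4 * k + 5 - t
  else (t : ℤ) - 4 * k

/-- Height table of the F3L block. [cite: EntingJensen2009, §7.4.2, Fig. 7.10] -/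
def f3lY (k a b c t : ℕ) : ℤ :=
  if t ≤ 2 * a + 1 then 0
  else if t ≤ 4 * a + 1 then -1
  else if t ≤ 4 * a + 2 * b + 3 then -2
  else if t ≤ 4 * a + 2 * k + 2 then -3
  else if t ≤ 4 * a + 2 * k + 2 * c + 2 then -2
  else if t ≤ 2 * a + 4 * k + 2 then -1
  else 0

/-- **The F3L block** with parameters `(a, b, c)`: `(0,0)→…→(2a+1,0)↓←…←(2,−1)↓(2,−2)→…→(2b+3,−2)↓(2b+3,−3)→…→(2k+1,−3)↑(2k+1,−2)←…←(2k+2−2c,−2)↑←…←(2a+3,−1)↑(2a+3,0)→…→(2k+2,0)`, length `6k+2`. [cite: EntingJensen2009, §7.4.2, Fig. 7.10] -/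
def f3l (k a b c : ℕ) : ℕ → Site 2 := Tab.walk (6 * k + 2) (f3lX k a b c) (f3lY k a b c)

/-- The 7 affine pieces of the F3L tables, with their values. [cite: EntingJensen2009, §7.4.2, Fig. 7.10] -/
private theorem f3l_cases (k a b c t : ℕ) :
    (t ≤ 2 * a + 1 ∧ f3lX k a b c t = (t : ℤ) ∧ f3lY k a b c t = 0) ∨
      (2 * a + 2 ≤ t ∧ t ≤ 4 * a + 1 ∧ f3lX k a b c t = 4 * (a : ℤ) + 3 - t ∧ f3lY k a b c t = -1) ∨
      (4 * a + 2 ≤ t ∧ t ≤ 4 * a + 2 * b + 3 ∧ f3lX k a b c t = (t : ℤ) - 4 * a ∧ f3lY k a b c t = -2) ∨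
      (4 * a + 2 * b + 4 ≤ t ∧ t ≤ 4 * a + 2 * k + 2 ∧ f3lX k a b c t = (t : ℤ) - 4 * a - 1 ∧ f3lY k a b c t = -3) ∨
      (4 * a + 2 * k + 3 ≤ t ∧ t ≤ 4 * a + 2 * k + 2 * c + 2 ∧ f3lX k a b c t = 4 * (a : ℤ) + 4 * k + 4 - t ∧ f3lY k a b c t = -2) ∨
      (4 * a + 2 * k + 2 * c + 3 ≤ t ∧ t ≤ 2 * a + 4 * k + 2 ∧ f3lX k a b c t = 4 * (a : ℤ) + 4 * k + 5 - t ∧ f3lY k a b c t = -1) ∨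
      (2 * a + 4 * k + 3 ≤ t ∧ f3lX k a b c t = (t : ℤ) - 4 * k ∧ f3lY k a b c t = 0) := by
  simp only [f3lX, f3lY]
  split_ifs <;> omega

/-- **Coordinate facts of the F3L block**: brick-wall steps, self-avoidance, lower half-plane, columns in
`[0, X_n]` and `≥ 1` after time `0`, start and end on the wall, even length — all on the affine pieces.
[cite: EntingJensen2009, §7.4.2, Fig. 7.10] [cite: MadrasSlade1993, §1.2, Definition 1.2.4 (bridges)] -/
theorem f3l_facts {k a b c : ℕ} (ha : 1 ≤ a) (hc : 1 ≤ c) (hac : a + c + 1 ≤ k) (hbc : b + c + 1 ≤ k) : Tab.Facts (6 * k + 2) (f3lX k a b c) (f3lY k a b c) := by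
  refine ⟨fun t ht => ?_, fun t ht s hs hx hy => ?_, fun t ht => ?_, fun t ht => ?_, ?_, ?_, ?_, by omega, fun t ht h1 => ?_⟩
  · rw [adjE_iff_st]
    rcases f3l_cases k a b c t with ⟨h, x, y⟩ | ⟨l, h, x, y⟩ | ⟨l, h, x, y⟩ | ⟨l, h, x, y⟩ | ⟨l, h, x, y⟩ | ⟨l, h, x, y⟩ | ⟨l, x, y⟩ <;>
      rcases f3l_cases k a b c (t + 1) with ⟨h', x', y'⟩ | ⟨l', h', x', y'⟩ | ⟨l', h', x', y'⟩ | ⟨l', h', x', y'⟩ | ⟨l', h', x', y'⟩ | ⟨l', h', x', y'⟩ | ⟨l', x', y'⟩ <;> omega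
  · rcases f3l_cases k a b c t with ⟨h, x, y⟩ | ⟨l, h, x, y⟩ | ⟨l, h, x, y⟩ | ⟨l, h, x, y⟩ | ⟨l, h, x, y⟩ | ⟨l, h, x, y⟩ | ⟨l, x, y⟩ <;>
      rcases f3l_cases k a b c s with ⟨h', x', y'⟩ | ⟨l', h', x', y'⟩ | ⟨l', h', x', y'⟩ | ⟨l', h', x', y'⟩ | ⟨l', h', x', y'⟩ | ⟨l', h', x', y'⟩ | ⟨l', x', y'⟩ <;> omega
  · rcases f3l_cases k a b c t with ⟨h, x, y⟩ | ⟨l, h, x, y⟩ | ⟨l, h, x, y⟩ | ⟨l, h, x, y⟩ | ⟨l, h, x, y⟩ | ⟨l, h, x, y⟩ | ⟨l, x, y⟩ <;> omega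
  · have h0 := f3l_cases k a b c 0
    have hL := f3l_cases k a b c (6 * k + 2)
    rcases f3l_cases k a b c t with ⟨h, x, y⟩ | ⟨l, h, x, y⟩ | ⟨l, h, x, y⟩ | ⟨l, h, x, y⟩ | ⟨l, h, x, y⟩ | ⟨l, h, x, y⟩ | ⟨l, x, y⟩ <;> omega
  · have h0 := f3l_cases k a b c 0; omega
  · have h0 := f3l_cases k a b c 0; omega
  · have hL := f3l_cases k a b c (6 * k + 2); omega
  · rcases f3l_cases k a b c t with ⟨h, x, y⟩ | ⟨l, h, x, y⟩ | ⟨l, h, x, y⟩ | ⟨l, h, x, y⟩ | ⟨l, h, x, y⟩ | ⟨l, h, x, y⟩ | ⟨l, x, y⟩ <;> omega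

/-- The F3L block is a positive wall bridge of length `m = 6k + 2` (length symbolic).
[cite: MadrasSlade1993, §1.2, Definition 1.2.4] [cite: EntingJensen2009, §7.4.2, Fig. 7.10] -/
theorem f3l_mem_pwb {k a b c m : ℕ} (ha : 1 ≤ a) (hc : 1 ≤ c) (hac : a + c + 1 ≤ k) (hbc : b + c + 1 ≤ k) (hm : m = 6 * k + 2) : f3l k a b c ∈ pwb m :=
  mem_pwb_of_facts rfl (f3l_facts ha hc hac hbc) hm

/-- Coordinates of the F3L block up to its length. [cite: EntingJensen2009, §7.4.2, Fig. 7.10] -/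
theorem f3l_apply {k a b c t : ℕ} (ht : t ≤ 6 * k + 2) : f3l k a b c t 0 = f3lX k a b c t ∧ f3l k a b c t 1 = f3lY k a b c t :=
  tab_walk_apply ht

/-- **The F3L block is irreducible** (length symbolic): the interior visits of the initial wall run (`t ≤ 2a`) are no renewal times because the walk is back in column `2 ≤ t` at time `4a+1`; those of the final wall run (`t ≥ 2a+4k+4`) because the row `−3` run reached column `2k+1 > X_t` at the earlier time `4a+2k+2`.
[cite: MadrasSlade1993, §4.2, Definition 4.2.1] [cite: Kesten1963SAW, §4] [cite: EntingJensen2009, §7.4.2, Fig. 7.10] -/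
theorem f3l_mem_ipwb {k a b c m : ℕ} (ha : 1 ≤ a) (hc : 1 ≤ c) (hac : a + c + 1 ≤ k) (hbc : b + c + 1 ≤ k) (hm : m = 6 * k + 2) : f3l k a b c ∈ ipwb m := by
  refine mem_ipwb_of_facts_wit rfl (f3l_facts ha hc hac hbc) hm (by omega) fun t ht1 ht2 hte hY => ?_
  rcases f3l_cases k a b c t with ⟨h, x, y⟩ | ⟨l, h, x, y⟩ | ⟨l, h, x, y⟩ | ⟨l, h, x, y⟩ | ⟨l, h, x, y⟩ | ⟨l, h, x, y⟩ | ⟨l, x, y⟩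
  · refine Or.inl ⟨4 * a + 1, by omega, by omega, ?_⟩
    rcases f3l_cases k a b c (4 * a + 1) with ⟨h', x', y'⟩ | ⟨l', h', x', y'⟩ | ⟨l', h', x', y'⟩ | ⟨l', h', x', y'⟩ | ⟨l', h', x', y'⟩ | ⟨l', h', x', y'⟩ | ⟨l', x', y'⟩ <;> omega
  · omega
  · omega
  · omega
  · omega
  · omega
  · refine Or.inr ⟨4 * a + 2 * k + 2, by omega, by omega, ?_⟩
    rcases f3l_cases k a b c (4 * a + 2 * k + 2) with ⟨h', x', y'⟩ | ⟨l', h', x', y'⟩ | ⟨l', h', x', y'⟩ | ⟨l', h', x', y'⟩ | ⟨l', h', x', y'⟩ | ⟨l', h', x', y'⟩ | ⟨l', x', y'⟩ <;> omega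

/-- **The F3L block has `k` visits**: `a` on the initial wall run (times `2, …, 2a`) and `k − a` on the final wall run.
[cite: BeatonBousquetMelouDeGierDuminilCopinGuttmann2014, §3.1 (arXiv v5 p. 8)] [cite: EntingJensen2009, §7.4.2, Fig. 7.10] -/
theorem visits_f3l {k a b c m : ℕ} (ha : 1 ≤ a) (hc : 1 ≤ c) (hac : a + c + 1 ≤ k) (hbc : b + c + 1 ≤ k) (hm : m = 6 * k + 2) : visits m (f3l k a b c) = k := by
  have hY : ∀ t, t ≤ 6 * k + 2 → f3l k a b c t 1 = f3lY k a b c t := fun t ht => (f3l_apply ht).2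
  have h1 : visits (0 + (2 * a + 1)) (f3l k a b c) = visits (0) (f3l k a b c) + ((0 + (2 * a + 1)) / 2 - (0) / 2) :=
    visits_add_of_wall fun q _ hq => by
      rw [hY _ (by omega)]
      rcases f3l_cases k a b c (0 + q) with ⟨h', x', y'⟩ | ⟨l', h', x', y'⟩ | ⟨l', h', x', y'⟩ | ⟨l', h', x', y'⟩ | ⟨l', h', x', y'⟩ | ⟨l', h', x', y'⟩ | ⟨l', x', y'⟩ <;> omega
  have h2 : visits (2 * a + 1 + (4 * k + 1)) (f3l k a b c) = visits (2 * a + 1) (f3l k a b c) :=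
    visits_add_eq_left fun q hq1 hq2 h => by
      obtain ⟨-, h0⟩ := h
      rw [hY _ (by omega)] at h0
      rcases f3l_cases k a b c (2 * a + 1 + q) with ⟨h', x', y'⟩ | ⟨l', h', x', y'⟩ | ⟨l', h', x', y'⟩ | ⟨l', h', x', y'⟩ | ⟨l', h', x', y'⟩ | ⟨l', h', x', y'⟩ | ⟨l', x', y'⟩ <;> omega
  have h3 : visits (2 * a + 4 * k + 2 + (2 * k - 2 * a)) (f3l k a b c) = visits (2 * a + 4 * k + 2) (f3l k a b c) + ((2 * a + 4 * k + 2 + (2 * k - 2 * a)) / 2 - (2 * a + 4 * k + 2) / 2) :=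
    visits_add_of_wall fun q _ hq => by
      rw [hY _ (by omega)]
      rcases f3l_cases k a b c (2 * a + 4 * k + 2 + q) with ⟨h', x', y'⟩ | ⟨l', h', x', y'⟩ | ⟨l', h', x', y'⟩ | ⟨l', h', x', y'⟩ | ⟨l', h', x', y'⟩ | ⟨l', h', x', y'⟩ | ⟨l', x', y'⟩ <;> omega
  rw [zero_add, visits_zero, zero_add] at h1
  rw [show 2 * a + 1 + (4 * k + 1) = 2 * a + 4 * k + 2 by omega, h1] at h2
  rw [show 2 * a + 4 * k + 2 + (2 * k - 2 * a) = 6 * k + 2 by omega, h2] at h3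
  subst hm
  rw [h3]
  omega

/-! ### §4  Family F3R: `hairpin(k−1) · R^{2b+1} D R^{2c} U R^{2k−3−2b−2c} U R U R`, profile `D D D U U U`, `X_n = 2k + 2` -/

/-- Column table of the F3R block (`1 ≤ c`, `b + c ≤ k−2`; length `6k+2`): wall run `(t,0)`, `t ≤ 2k−1`; return run `(4k−1−t,−1)` to column `2`; row `−2` run `(t+4−4k,−2)` to column `2b+3`; row `−3` run `(t+3−4k,−3)` to column `2b+2c+3`; row `−2` run `(t+2−4k,−2)` to column `2k`; exit `(2k,−1)(2k+1,−1)(2k+1,0)(2k+2,0)`. [cite: EntingJensen2009, §7.4.2, Fig. 7.10 (brickwork form of the honeycomb lattice)] -/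
def f3rX (k b c t : ℕ) : ℤ :=
  if t + 1 ≤ 2 * k then (t : ℤ)
  else if t + 3 ≤ 4 * k then 4 * (k : ℤ) - 1 - t
  else if t + 1 ≤ 4 * k + 2 * b then (t : ℤ) + 4 - 4 * k
  else if t ≤ 4 * k + 2 * b + 2 * c then (t : ℤ) + 3 - 4 * k
  else if t + 2 ≤ 6 * k then (t : ℤ) + 2 - 4 * k
  else if t ≤ 6 * k then (t : ℤ) + 1 - 4 * k
  else (t : ℤ) - 4 * k

/-- Height table of the F3R block. [cite: EntingJensen2009, §7.4.2, Fig. 7.10] -/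
def f3rY (k b c t : ℕ) : ℤ :=
  if t + 1 ≤ 2 * k then 0
  else if t + 3 ≤ 4 * k then -1
  else if t + 1 ≤ 4 * k + 2 * b then -2
  else if t ≤ 4 * k + 2 * b + 2 * c then -3
  else if t + 2 ≤ 6 * k then -2
  else if t ≤ 6 * k then -1
  else 0

/-- **The F3R block** with parameters `(b, c)`: `(0,0)→…→(2k−1,0)↓←…←(2,−1)↓(2,−2)→…→(2b+3,−2)↓(2b+3,−3)→…→(2b+2c+3,−3)↑→…→(2k,−2)↑(2k,−1)→(2k+1,−1)↑(2k+1,0)→(2k+2,0)`, length `6k+2`. [cite: EntingJensen2009, §7.4.2, Fig. 7.10] -/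
def f3r (k b c : ℕ) : ℕ → Site 2 := Tab.walk (6 * k + 2) (f3rX k b c) (f3rY k b c)

/-- The 7 affine pieces of the F3R tables, with their values. [cite: EntingJensen2009, §7.4.2, Fig. 7.10] -/
private theorem f3r_cases (k b c t : ℕ) :
    (t + 1 ≤ 2 * k ∧ f3rX k b c t = (t : ℤ) ∧ f3rY k b c t = 0) ∨
      (2 * k ≤ t ∧ t + 3 ≤ 4 * k ∧ f3rX k b c t = 4 * (k : ℤ) - 1 - t ∧ f3rY k b c t = -1) ∨
      (4 * k ≤ t + 2 ∧ t + 1 ≤ 4 * k + 2 * b ∧ f3rX k b c t = (t : ℤ) + 4 - 4 * k ∧ f3rY k b c t = -2) ∨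
      (4 * k + 2 * b ≤ t ∧ t ≤ 4 * k + 2 * b + 2 * c ∧ f3rX k b c t = (t : ℤ) + 3 - 4 * k ∧ f3rY k b c t = -3) ∨
      (4 * k + 2 * b + 2 * c + 1 ≤ t ∧ t + 2 ≤ 6 * k ∧ f3rX k b c t = (t : ℤ) + 2 - 4 * k ∧ f3rY k b c t = -2) ∨
      (6 * k ≤ t + 1 ∧ t ≤ 6 * k ∧ f3rX k b c t = (t : ℤ) + 1 - 4 * k ∧ f3rY k b c t = -1) ∨
      (6 * k + 1 ≤ t ∧ f3rX k b c t = (t : ℤ) - 4 * k ∧ f3rY k b c t = 0) := by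
  simp only [f3rX, f3rY]
  split_ifs <;> omega

/-- **Coordinate facts of the F3R block**: brick-wall steps, self-avoidance, lower half-plane, columns in
`[0, X_n]` and `≥ 1` after time `0`, start and end on the wall, even length — all on the affine pieces.
[cite: EntingJensen2009, §7.4.2, Fig. 7.10] [cite: MadrasSlade1993, §1.2, Definition 1.2.4 (bridges)] -/
theorem f3r_facts {k b c : ℕ} (hc : 1 ≤ c) (hbc : b + c + 2 ≤ k) : Tab.Facts (6 * k + 2) (f3rX k b c) (f3rY k b c) := by
  refine ⟨fun t ht => ?_, fun t ht s hs hx hy => ?_, fun t ht => ?_, fun t ht => ?_, ?_, ?_, ?_, by omega, fun t ht h1 => ?_⟩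
  · rw [adjE_iff_st]
    rcases f3r_cases k b c t with ⟨h, x, y⟩ | ⟨l, h, x, y⟩ | ⟨l, h, x, y⟩ | ⟨l, h, x, y⟩ | ⟨l, h, x, y⟩ | ⟨l, h, x, y⟩ | ⟨l, x, y⟩ <;>
      rcases f3r_cases k b c (t + 1) with ⟨h', x', y'⟩ | ⟨l', h', x', y'⟩ | ⟨l', h', x', y'⟩ | ⟨l', h', x', y'⟩ | ⟨l', h', x', y'⟩ | ⟨l', h', x', y'⟩ | ⟨l', x', y'⟩ <;> omega
  · rcases f3r_cases k b c t with ⟨h, x, y⟩ | ⟨l, h, x, y⟩ | ⟨l, h, x, y⟩ | ⟨l, h, x, y⟩ | ⟨l, h, x, y⟩ | ⟨l, h, x, y⟩ | ⟨l, x, y⟩ <;>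
      rcases f3r_cases k b c s with ⟨h', x', y'⟩ | ⟨l', h', x', y'⟩ | ⟨l', h', x', y'⟩ | ⟨l', h', x', y'⟩ | ⟨l', h', x', y'⟩ | ⟨l', h', x', y'⟩ | ⟨l', x', y'⟩ <;> omega
  · rcases f3r_cases k b c t with ⟨h, x, y⟩ | ⟨l, h, x, y⟩ | ⟨l, h, x, y⟩ | ⟨l, h, x, y⟩ | ⟨l, h, x, y⟩ | ⟨l, h, x, y⟩ | ⟨l, x, y⟩ <;> omega
  · have h0 := f3r_cases k b c 0
    have hL := f3r_cases k b c (6 * k + 2)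
    rcases f3r_cases k b c t with ⟨h, x, y⟩ | ⟨l, h, x, y⟩ | ⟨l, h, x, y⟩ | ⟨l, h, x, y⟩ | ⟨l, h, x, y⟩ | ⟨l, h, x, y⟩ | ⟨l, x, y⟩ <;> omega
  · have h0 := f3r_cases k b c 0; omega
  · have h0 := f3r_cases k b c 0; omega
  · have hL := f3r_cases k b c (6 * k + 2); omega
  · rcases f3r_cases k b c t with ⟨h, x, y⟩ | ⟨l, h, x, y⟩ | ⟨l, h, x, y⟩ | ⟨l, h, x, y⟩ | ⟨l, h, x, y⟩ | ⟨l, h, x, y⟩ | ⟨l, x, y⟩ <;> omega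

/-- The F3R block is a positive wall bridge of length `m = 6k + 2` (length symbolic).
[cite: MadrasSlade1993, §1.2, Definition 1.2.4] [cite: EntingJensen2009, §7.4.2, Fig. 7.10] -/
theorem f3r_mem_pwb {k b c m : ℕ} (hc : 1 ≤ c) (hbc : b + c + 2 ≤ k) (hm : m = 6 * k + 2) : f3r k b c ∈ pwb m :=
  mem_pwb_of_facts rfl (f3r_facts hc hbc) hm

/-- Coordinates of the F3R block up to its length. [cite: EntingJensen2009, §7.4.2, Fig. 7.10] -/
theorem f3r_apply {k b c t : ℕ} (ht : t ≤ 6 * k + 2) : f3r k b c t 0 = f3rX k b c t ∧ f3r k b c t 1 = f3rY k b c t :=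
  tab_walk_apply ht

/-- **The F3R block is irreducible** (length symbolic): the interior visits (times `t ≤ 2k−2` of the wall run) are no renewal times because the walk is back in column `2 ≤ t` at time `4k−3`.
[cite: MadrasSlade1993, §4.2, Definition 4.2.1] [cite: Kesten1963SAW, §4] [cite: EntingJensen2009, §7.4.2, Fig. 7.10] -/
theorem f3r_mem_ipwb {k b c m : ℕ} (hc : 1 ≤ c) (hbc : b + c + 2 ≤ k) (hm : m = 6 * k + 2) : f3r k b c ∈ ipwb m := by
  refine mem_ipwb_of_facts_wit rfl (f3r_facts hc hbc) hm (by omega) fun t ht1 ht2 hte hY => ?_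
  rcases f3r_cases k b c t with ⟨h, x, y⟩ | ⟨l, h, x, y⟩ | ⟨l, h, x, y⟩ | ⟨l, h, x, y⟩ | ⟨l, h, x, y⟩ | ⟨l, h, x, y⟩ | ⟨l, x, y⟩
  · refine Or.inl ⟨4 * k - 3, by omega, by omega, ?_⟩
    rcases f3r_cases k b c (4 * k - 3) with ⟨h', x', y'⟩ | ⟨l', h', x', y'⟩ | ⟨l', h', x', y'⟩ | ⟨l', h', x', y'⟩ | ⟨l', h', x', y'⟩ | ⟨l', h', x', y'⟩ | ⟨l', x', y'⟩ <;> omega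
  · omega
  · omega
  · omega
  · omega
  · omega
  · omega

/-- **The F3R block has `k` visits**: `k − 1` on the initial wall run and the endpoint.
[cite: BeatonBousquetMelouDeGierDuminilCopinGuttmann2014, §3.1 (arXiv v5 p. 8)] [cite: EntingJensen2009, §7.4.2, Fig. 7.10] -/
theorem visits_f3r {k b c m : ℕ} (hc : 1 ≤ c) (hbc : b + c + 2 ≤ k) (hm : m = 6 * k + 2) : visits m (f3r k b c) = k := by
  have hY : ∀ t, t ≤ 6 * k + 2 → f3r k b c t 1 = f3rY k b c t := fun t ht => (f3r_apply ht).2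
  have h1 : visits (0 + (2 * k - 1)) (f3r k b c) = visits (0) (f3r k b c) + ((0 + (2 * k - 1)) / 2 - (0) / 2) :=
    visits_add_of_wall fun q _ hq => by
      rw [hY _ (by omega)]
      rcases f3r_cases k b c (0 + q) with ⟨h', x', y'⟩ | ⟨l', h', x', y'⟩ | ⟨l', h', x', y'⟩ | ⟨l', h', x', y'⟩ | ⟨l', h', x', y'⟩ | ⟨l', h', x', y'⟩ | ⟨l', x', y'⟩ <;> omega
  have h2 : visits (2 * k - 1 + (4 * k + 1)) (f3r k b c) = visits (2 * k - 1) (f3r k b c) :=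
    visits_add_eq_left fun q hq1 hq2 h => by
      obtain ⟨-, h0⟩ := h
      rw [hY _ (by omega)] at h0
      rcases f3r_cases k b c (2 * k - 1 + q) with ⟨h', x', y'⟩ | ⟨l', h', x', y'⟩ | ⟨l', h', x', y'⟩ | ⟨l', h', x', y'⟩ | ⟨l', h', x', y'⟩ | ⟨l', h', x', y'⟩ | ⟨l', x', y'⟩ <;> omega
  have h3 : visits (6 * k + (2)) (f3r k b c) = visits (6 * k) (f3r k b c) + ((6 * k + (2)) / 2 - (6 * k) / 2) :=
    visits_add_of_wall fun q _ hq => by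
      rw [hY _ (by omega)]
      rcases f3r_cases k b c (6 * k + q) with ⟨h', x', y'⟩ | ⟨l', h', x', y'⟩ | ⟨l', h', x', y'⟩ | ⟨l', h', x', y'⟩ | ⟨l', h', x', y'⟩ | ⟨l', h', x', y'⟩ | ⟨l', x', y'⟩ <;> omega
  rw [zero_add, visits_zero, zero_add] at h1
  rw [show 2 * k - 1 + (4 * k + 1) = 6 * k by omega, h1] at h2
  rw [show 6 * k + (2) = 6 * k + 2 by omega, h2] at h3
  subst hm
  rw [h3]
  omega


/-! ### §5  The families are disjoint and injectively parametrised (values at discriminating times) -/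

/-- Two F2a blocks with `a < a'` differ at time `2a + 2` (row `−1` against row `0`). [cite: EntingJensen2009, §7.4.2, Fig. 7.10] -/
private theorem f2a_ne_of_lt {k a a' : ℕ} (ha : 1 ≤ a) (h : a < a') (ha'k : a' + 1 ≤ k) : f2a k a ≠ f2a k a' := by
  intro e
  have e1 := congrArg (fun w : ℕ → Site 2 => w (2 * a + 2) 1) e
  rw [(f2a_apply (by omega)).2, (f2a_apply (by omega)).2] at e1
  rcases f2a_cases k a (2 * a + 2) with ⟨h1, x, y⟩ | ⟨l, h1, x, y⟩ | ⟨l, h1, x, y⟩ | ⟨l, h1, x, y⟩ | ⟨l, x, y⟩ <;>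
    rcases f2a_cases k a' (2 * a + 2) with ⟨h1', x', y'⟩ | ⟨l', h1', x', y'⟩ | ⟨l', h1', x', y'⟩ | ⟨l', h1', x', y'⟩ |
      ⟨l', x', y'⟩ <;> omega

/-- The parameter `j` of an F2b/F2c block is read off at time `6k − 3` (row `−2` for `j = 1`, row `−1` for `j = 0`).
[cite: EntingJensen2009, §7.4.2, Fig. 7.10] -/
private theorem f2bc_inj {k j j' : ℕ} (hk : 2 ≤ k) (hj : j ≤ 1) (hj' : j' ≤ 1) (e : f2bc k j = f2bc k j') : j = j' := by
  have e1 := congrArg (fun w : ℕ → Site 2 => w (6 * k - 3) 1) e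
  rw [(f2bc_apply (by omega)).2, (f2bc_apply (by omega)).2] at e1
  rcases f2bc_cases k j (6 * k - 3) with ⟨h1, x, y⟩ | ⟨l, h1, x, y⟩ | ⟨l, h1, x, y⟩ | ⟨l, h1, x, y⟩ | ⟨l, x, y⟩ <;>
    rcases f2bc_cases k j' (6 * k - 3) with ⟨h1', x', y'⟩ | ⟨l', h1', x', y'⟩ | ⟨l', h1', x', y'⟩ | ⟨l', h1', x', y'⟩ |
      ⟨l', x', y'⟩ <;> omega

/-- Two F3L blocks with `a < a'` differ at time `2a + 2` (row `−1` against row `0`). [cite: EntingJensen2009, §7.4.2, Fig. 7.10] -/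
private theorem f3l_ne_of_lt_a {k a b c a' b' c' : ℕ} (ha : 1 ≤ a) (h : a < a') (ha'k : a' + 2 ≤ k) :
    f3l k a b c ≠ f3l k a' b' c' := by
  intro e
  have e1 := congrArg (fun w : ℕ → Site 2 => w (2 * a + 2) 1) e
  rw [(f3l_apply (by omega)).2, (f3l_apply (by omega)).2] at e1
  rcases f3l_cases k a b c (2 * a + 2) with ⟨h1, x, y⟩ | ⟨l, h1, x, y⟩ | ⟨l, h1, x, y⟩ | ⟨l, h1, x, y⟩ | ⟨l, h1, x, y⟩ |
      ⟨l, h1, x, y⟩ | ⟨l, x, y⟩ <;>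
    rcases f3l_cases k a' b' c' (2 * a + 2) with ⟨h1', x', y'⟩ | ⟨l', h1', x', y'⟩ | ⟨l', h1', x', y'⟩ | ⟨l', h1', x', y'⟩ |
      ⟨l', h1', x', y'⟩ | ⟨l', h1', x', y'⟩ | ⟨l', x', y'⟩ <;> omega

/-- Two F3L blocks with the same `a` and `b < b'` differ at time `4a + 2b + 4` (row `−3` against row `−2`).
[cite: EntingJensen2009, §7.4.2, Fig. 7.10] -/
private theorem f3l_ne_of_lt_b {k a b c b' c' : ℕ} (hak : a + 2 ≤ k) (hbk : b + 2 ≤ k) (h : b < b') :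
    f3l k a b c ≠ f3l k a b' c' := by
  intro e
  have e1 := congrArg (fun w : ℕ → Site 2 => w (4 * a + 2 * b + 4) 1) e
  rw [(f3l_apply (by omega)).2, (f3l_apply (by omega)).2] at e1
  rcases f3l_cases k a b c (4 * a + 2 * b + 4) with ⟨h1, x, y⟩ | ⟨l, h1, x, y⟩ | ⟨l, h1, x, y⟩ | ⟨l, h1, x, y⟩ |
      ⟨l, h1, x, y⟩ | ⟨l, h1, x, y⟩ | ⟨l, x, y⟩ <;>
    rcases f3l_cases k a b' c' (4 * a + 2 * b + 4) with ⟨h1', x', y'⟩ | ⟨l', h1', x', y'⟩ | ⟨l', h1', x', y'⟩ |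
      ⟨l', h1', x', y'⟩ | ⟨l', h1', x', y'⟩ | ⟨l', h1', x', y'⟩ | ⟨l', x', y'⟩ <;> omega

/-- Two F3L blocks with the same `a, b` and `c < c'` differ at time `4a + 2k + 2c + 3` (row `−1` against row `−2`).
[cite: EntingJensen2009, §7.4.2, Fig. 7.10] -/
private theorem f3l_ne_of_lt_c {k a b c c' : ℕ} (hack : a + c + 1 ≤ k) (hbck : b + c + 1 ≤ k) (h : c < c') :
    f3l k a b c ≠ f3l k a b c' := by
  intro e
  have e1 := congrArg (fun w : ℕ → Site 2 => w (4 * a + 2 * k + 2 * c + 3) 1) e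
  rw [(f3l_apply (by omega)).2, (f3l_apply (by omega)).2] at e1
  rcases f3l_cases k a b c (4 * a + 2 * k + 2 * c + 3) with ⟨h1, x, y⟩ | ⟨l, h1, x, y⟩ | ⟨l, h1, x, y⟩ | ⟨l, h1, x, y⟩ |
      ⟨l, h1, x, y⟩ | ⟨l, h1, x, y⟩ | ⟨l, x, y⟩ <;>
    rcases f3l_cases k a b c' (4 * a + 2 * k + 2 * c + 3) with ⟨h1', x', y'⟩ | ⟨l', h1', x', y'⟩ | ⟨l', h1', x', y'⟩ |
      ⟨l', h1', x', y'⟩ | ⟨l', h1', x', y'⟩ | ⟨l', h1', x', y'⟩ | ⟨l', x', y'⟩ <;> omega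

/-- Two F3R blocks with `b < b'` differ at time `4k + 2b` (row `−3` against row `−2`). [cite: EntingJensen2009, §7.4.2, Fig. 7.10] -/
private theorem f3r_ne_of_lt_b {k b c b' c' : ℕ} (hbk : b + 2 ≤ k) (h : b < b') : f3r k b c ≠ f3r k b' c' := by
  intro e
  have e1 := congrArg (fun w : ℕ → Site 2 => w (4 * k + 2 * b) 1) e
  rw [(f3r_apply (by omega)).2, (f3r_apply (by omega)).2] at e1
  rcases f3r_cases k b c (4 * k + 2 * b) with ⟨h1, x, y⟩ | ⟨l, h1, x, y⟩ | ⟨l, h1, x, y⟩ | ⟨l, h1, x, y⟩ |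
      ⟨l, h1, x, y⟩ | ⟨l, h1, x, y⟩ | ⟨l, x, y⟩ <;>
    rcases f3r_cases k b' c' (4 * k + 2 * b) with ⟨h1', x', y'⟩ | ⟨l', h1', x', y'⟩ | ⟨l', h1', x', y'⟩ |
      ⟨l', h1', x', y'⟩ | ⟨l', h1', x', y'⟩ | ⟨l', h1', x', y'⟩ | ⟨l', x', y'⟩ <;> omega

/-- Two F3R blocks with the same `b` and `c < c'` differ at time `4k + 2b + 2c + 1` (row `−2` against row `−3`).
[cite: EntingJensen2009, §7.4.2, Fig. 7.10] -/
private theorem f3r_ne_of_lt_c {k b c c' : ℕ} (hbck : b + c + 2 ≤ k) (h : c < c') : f3r k b c ≠ f3r k b c' := by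
  intro e
  have e1 := congrArg (fun w : ℕ → Site 2 => w (4 * k + 2 * b + 2 * c + 1) 1) e
  rw [(f3r_apply (by omega)).2, (f3r_apply (by omega)).2] at e1
  rcases f3r_cases k b c (4 * k + 2 * b + 2 * c + 1) with ⟨h1, x, y⟩ | ⟨l, h1, x, y⟩ | ⟨l, h1, x, y⟩ | ⟨l, h1, x, y⟩ |
      ⟨l, h1, x, y⟩ | ⟨l, h1, x, y⟩ | ⟨l, x, y⟩ <;>
    rcases f3r_cases k b c' (4 * k + 2 * b + 2 * c + 1) with ⟨h1', x', y'⟩ | ⟨l', h1', x', y'⟩ | ⟨l', h1', x', y'⟩ |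
      ⟨l', h1', x', y'⟩ | ⟨l', h1', x', y'⟩ | ⟨l', h1', x', y'⟩ | ⟨l', x', y'⟩ <;> omega

/-- An F2a block ends in column `2k + 2`, an F2b/F2c block in column `2k + 4`. [cite: EntingJensen2009, §7.4.2, Fig. 7.10] -/
private theorem f2a_ne_f2bc {k a j : ℕ} (hak : a + 1 ≤ k) (hj : j ≤ 1) : f2a k a ≠ f2bc k j := by
  intro e
  have e1 := congrArg (fun w : ℕ → Site 2 => w (6 * k + 2) 0) e
  rw [(f2a_apply le_rfl).1, (f2bc_apply le_rfl).1] at e1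
  rcases f2a_cases k a (6 * k + 2) with ⟨h1, x, y⟩ | ⟨l, h1, x, y⟩ | ⟨l, h1, x, y⟩ | ⟨l, h1, x, y⟩ | ⟨l, x, y⟩ <;>
    rcases f2bc_cases k j (6 * k + 2) with ⟨h1', x', y'⟩ | ⟨l', h1', x', y'⟩ | ⟨l', h1', x', y'⟩ | ⟨l', h1', x', y'⟩ |
      ⟨l', x', y'⟩ <;> omega

/-- An F3L block ends in column `2k + 2`, an F2b/F2c block in column `2k + 4`. [cite: EntingJensen2009, §7.4.2, Fig. 7.10] -/
private theorem f3l_ne_f2bc {k a b c j : ℕ} (hak : a + 1 ≤ k) (hj : j ≤ 1) : f3l k a b c ≠ f2bc k j := by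
  intro e
  have e1 := congrArg (fun w : ℕ → Site 2 => w (6 * k + 2) 0) e
  rw [(f3l_apply le_rfl).1, (f2bc_apply le_rfl).1] at e1
  rcases f3l_cases k a b c (6 * k + 2) with ⟨h1, x, y⟩ | ⟨l, h1, x, y⟩ | ⟨l, h1, x, y⟩ | ⟨l, h1, x, y⟩ | ⟨l, h1, x, y⟩ |
      ⟨l, h1, x, y⟩ | ⟨l, x, y⟩ <;>
    rcases f2bc_cases k j (6 * k + 2) with ⟨h1', x', y'⟩ | ⟨l', h1', x', y'⟩ | ⟨l', h1', x', y'⟩ | ⟨l', h1', x', y'⟩ |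
      ⟨l', x', y'⟩ <;> omega

/-- An F3R block ends in column `2k + 2`, an F2b/F2c block in column `2k + 4`. [cite: EntingJensen2009, §7.4.2, Fig. 7.10] -/
private theorem f3r_ne_f2bc {k b c j : ℕ} (hj : j ≤ 1) : f3r k b c ≠ f2bc k j := by
  intro e
  have e1 := congrArg (fun w : ℕ → Site 2 => w (6 * k + 2) 0) e
  rw [(f3r_apply le_rfl).1, (f2bc_apply le_rfl).1] at e1
  rcases f3r_cases k b c (6 * k + 2) with ⟨h1, x, y⟩ | ⟨l, h1, x, y⟩ | ⟨l, h1, x, y⟩ | ⟨l, h1, x, y⟩ | ⟨l, h1, x, y⟩ |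
      ⟨l, h1, x, y⟩ | ⟨l, x, y⟩ <;>
    rcases f2bc_cases k j (6 * k + 2) with ⟨h1', x', y'⟩ | ⟨l', h1', x', y'⟩ | ⟨l', h1', x', y'⟩ | ⟨l', h1', x', y'⟩ |
      ⟨l', x', y'⟩ <;> omega

/-- An F3L block is in row `−3` at time `4a' + 2k + 2`; an F2a block never is. [cite: EntingJensen2009, §7.4.2, Fig. 7.10] -/
private theorem f2a_ne_f3l {k a a' b' c' : ℕ} (ha'k : a' + 1 ≤ k) (hb'k : b' + 2 ≤ k) : f2a k a ≠ f3l k a' b' c' := by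
  intro e
  have e1 := congrArg (fun w : ℕ → Site 2 => w (4 * a' + 2 * k + 2) 1) e
  rw [(f2a_apply (by omega)).2, (f3l_apply (by omega)).2] at e1
  rcases f2a_cases k a (4 * a' + 2 * k + 2) with ⟨h1, x, y⟩ | ⟨l, h1, x, y⟩ | ⟨l, h1, x, y⟩ | ⟨l, h1, x, y⟩ | ⟨l, x, y⟩ <;>
    rcases f3l_cases k a' b' c' (4 * a' + 2 * k + 2) with ⟨h1', x', y'⟩ | ⟨l', h1', x', y'⟩ | ⟨l', h1', x', y'⟩ |
      ⟨l', h1', x', y'⟩ | ⟨l', h1', x', y'⟩ | ⟨l', h1', x', y'⟩ | ⟨l', x', y'⟩ <;> omega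

/-- An F3R block is in row `−3` at time `4k + 2b'`; an F2a block never is. [cite: EntingJensen2009, §7.4.2, Fig. 7.10] -/
private theorem f2a_ne_f3r {k a b' c' : ℕ} (hb'k : b' + 2 ≤ k) : f2a k a ≠ f3r k b' c' := by
  intro e
  have e1 := congrArg (fun w : ℕ → Site 2 => w (4 * k + 2 * b') 1) e
  rw [(f2a_apply (by omega)).2, (f3r_apply (by omega)).2] at e1
  rcases f2a_cases k a (4 * k + 2 * b') with ⟨h1, x, y⟩ | ⟨l, h1, x, y⟩ | ⟨l, h1, x, y⟩ | ⟨l, h1, x, y⟩ | ⟨l, x, y⟩ <;>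
    rcases f3r_cases k b' c' (4 * k + 2 * b') with ⟨h1', x', y'⟩ | ⟨l', h1', x', y'⟩ | ⟨l', h1', x', y'⟩ |
      ⟨l', h1', x', y'⟩ | ⟨l', h1', x', y'⟩ | ⟨l', h1', x', y'⟩ | ⟨l', x', y'⟩ <;> omega

/-- An F3L block is in row `−1` at time `2a + 2`, an F3R block still on the wall. [cite: EntingJensen2009, §7.4.2, Fig. 7.10] -/
private theorem f3l_ne_f3r {k a b c b' c' : ℕ} (ha : 1 ≤ a) (hak : a + 2 ≤ k) : f3l k a b c ≠ f3r k b' c' := by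
  intro e
  have e1 := congrArg (fun w : ℕ → Site 2 => w (2 * a + 2) 1) e
  rw [(f3l_apply (by omega)).2, (f3r_apply (by omega)).2] at e1
  rcases f3l_cases k a b c (2 * a + 2) with ⟨h1, x, y⟩ | ⟨l, h1, x, y⟩ | ⟨l, h1, x, y⟩ | ⟨l, h1, x, y⟩ | ⟨l, h1, x, y⟩ |
      ⟨l, h1, x, y⟩ | ⟨l, x, y⟩ <;>
    rcases f3r_cases k b' c' (2 * a + 2) with ⟨h1', x', y'⟩ | ⟨l', h1', x', y'⟩ | ⟨l', h1', x', y'⟩ |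
      ⟨l', h1', x', y'⟩ | ⟨l', h1', x', y'⟩ | ⟨l', h1', x', y'⟩ | ⟨l', x', y'⟩ <;> omega

/-! ### §6  The slack-two Finset: `2 + Σ_{j<k} j²` distinct irreducible blocks of length `6k + 2` with `k` visits -/

open Classical in
/-- The `k − 1` F2a blocks (hairpin parameter `a = 1, …, k − 1`). [cite: EntingJensen2009, §7.4.2, Fig. 7.10] -/
noncomputable def f2aBlocks (k : ℕ) : Finset (ℕ → Site 2) := (range (k - 1)).image fun a => f2a k (a + 1)

open Classical in
/-- The two blocks F2c (`j = 0`) and F2b (`j = 1`). [cite: EntingJensen2009, §7.4.2, Fig. 7.10] -/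
noncomputable def f2bcBlocks (k : ℕ) : Finset (ℕ → Site 2) := (range 2).image (f2bc k)

/-- Index set of the F3L family: `w = k − 1 − c ∈ [0, k−2]` (so `c ≥ 1`), `a ∈ [1, w]`, `b ∈ [0, w]`; `Σ_{w<k−1} w(w+1)` triples.
[folklore] -/
def f3lIdx (k : ℕ) : Finset (Σ _ : ℕ, ℕ × ℕ) := (range (k - 1)).sigma fun w => Icc 1 w ×ˢ range (w + 1)

open Classical in
/-- The F3L blocks, parametrised by `f3lIdx k` through `(w, a, b) ↦ f3l k a b (k − 1 − w)`. [cite: EntingJensen2009, §7.4.2, Fig. 7.10] -/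
noncomputable def f3lBlocks (k : ℕ) : Finset (ℕ → Site 2) := (f3lIdx k).image fun p => f3l k p.2.1 p.2.2 (k - 1 - p.1)

/-- Index set of the F3R family: `w = k − 2 − c ∈ [0, k−3]` (so `c ≥ 1`), `b ∈ [0, w]`; `Σ_{w<k−2} (w+1)` pairs. [folklore] -/
def f3rIdx (k : ℕ) : Finset (Σ _ : ℕ, ℕ) := (range (k - 2)).sigma fun w => range (w + 1)

open Classical in
/-- The F3R blocks, parametrised by `f3rIdx k` through `(w, b) ↦ f3r k b (k − 2 − w)`. [cite: EntingJensen2009, §7.4.2, Fig. 7.10] -/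
noncomputable def f3rBlocks (k : ℕ) : Finset (ℕ → Site 2) := (f3rIdx k).image fun p => f3r k p.2 (k - 2 - p.1)

open Classical in
/-- **The slack-two Finset**: all F2a, F2b, F2c, F3L, F3R blocks of length `6k + 2`. [cite: EntingJensen2009, §7.4.2, Fig. 7.10]
[cite: MadrasSlade1993, §4.2, Definition 4.2.1] -/
noncomputable def slackTwoBlocks (k : ℕ) : Finset (ℕ → Site 2) := f2aBlocks k ∪ f2bcBlocks k ∪ f3lBlocks k ∪ f3rBlocks k

open Classical in
/-- `#f2aBlocks k = k − 1`. [cite: EntingJensen2009, §7.4.2, Fig. 7.10] -/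
theorem card_f2aBlocks (k : ℕ) : #(f2aBlocks k) = k - 1 := by
  rw [f2aBlocks, card_image_of_injOn, card_range]
  intro a ha a' ha' e
  simp only [coe_range, Set.mem_Iio] at ha ha'
  by_contra hne
  rcases Nat.lt_or_gt_of_ne hne with h | h
  · exact f2a_ne_of_lt (by omega) (by omega) (by omega) e
  · exact f2a_ne_of_lt (by omega) (by omega) (by omega) e.symm

open Classical in
/-- `#f2bcBlocks k = 2` (`k ≥ 2`). [cite: EntingJensen2009, §7.4.2, Fig. 7.10] -/
theorem card_f2bcBlocks {k : ℕ} (hk : 2 ≤ k) : #(f2bcBlocks k) = 2 := by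
  rw [f2bcBlocks, card_image_of_injOn, card_range]
  intro j hj j' hj' e
  simp only [coe_range, Set.mem_Iio] at hj hj'
  exact f2bc_inj hk (by omega) (by omega) e

/-- `#f3lIdx k = Σ_{w<k−1} w(w+1)`. [folklore] -/
private theorem card_f3lIdx (k : ℕ) : #(f3lIdx k) = ∑ w ∈ range (k - 1), w * (w + 1) := by
  rw [f3lIdx, card_sigma]
  refine sum_congr rfl fun w _ => ?_
  rw [card_product, Nat.card_Icc, card_range, Nat.add_sub_cancel]

/-- `#f3rIdx k = Σ_{w<k−2} (w+1)`. [folklore] -/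
private theorem card_f3rIdx (k : ℕ) : #(f3rIdx k) = ∑ w ∈ range (k - 2), (w + 1) := by
  rw [f3rIdx, card_sigma]
  exact sum_congr rfl fun w _ => card_range _

open Classical in
/-- The F3L parametrisation is injective on its index set: `#f3lBlocks k = Σ_{w<k−1} w(w+1)`. [cite: EntingJensen2009, §7.4.2, Fig. 7.10] -/
theorem card_f3lBlocks (k : ℕ) : #(f3lBlocks k) = ∑ w ∈ range (k - 1), w * (w + 1) := by
  rw [f3lBlocks, card_image_of_injOn, card_f3lIdx]
  rintro ⟨w, a, b⟩ hp ⟨w', a', b'⟩ hp' e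
  simp only [f3lIdx, coe_sigma, Set.mem_sigma_iff, coe_range, Set.mem_Iio, coe_product, Set.mem_prod, coe_Icc,
    Set.mem_Icc] at hp hp' e
  obtain rfl : a = a' := by
    by_contra hne
    rcases Nat.lt_or_gt_of_ne hne with h | h
    · exact f3l_ne_of_lt_a (by omega) h (by omega) e
    · exact f3l_ne_of_lt_a (by omega) h (by omega) e.symm
  obtain rfl : b = b' := by
    by_contra hne
    rcases Nat.lt_or_gt_of_ne hne with h | h
    · exact f3l_ne_of_lt_b (by omega) (by omega) h e
    · exact f3l_ne_of_lt_b (by omega) (by omega) h e.symm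
  obtain rfl : w = w' := by
    by_contra hne
    rcases Nat.lt_or_gt_of_ne hne with h | h
    · exact f3l_ne_of_lt_c (c := k - 1 - w') (by omega) (by omega) (by omega) e.symm
    · exact f3l_ne_of_lt_c (c := k - 1 - w) (by omega) (by omega) (by omega) e
  rfl

open Classical in
/-- The F3R parametrisation is injective on its index set: `#f3rBlocks k = Σ_{w<k−2} (w+1)`. [cite: EntingJensen2009, §7.4.2, Fig. 7.10] -/
theorem card_f3rBlocks (k : ℕ) : #(f3rBlocks k) = ∑ w ∈ range (k - 2), (w + 1) := by
  rw [f3rBlocks, card_image_of_injOn, card_f3rIdx]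
  rintro ⟨w, b⟩ hp ⟨w', b'⟩ hp' e
  simp only [f3rIdx, coe_sigma, Set.mem_sigma_iff, coe_range, Set.mem_Iio] at hp hp' e
  obtain rfl : b = b' := by
    by_contra hne
    rcases Nat.lt_or_gt_of_ne hne with h | h
    · exact f3r_ne_of_lt_b (by omega) h e
    · exact f3r_ne_of_lt_b (by omega) h e.symm
  obtain rfl : w = w' := by
    by_contra hne
    rcases Nat.lt_or_gt_of_ne hne with h | h
    · exact f3r_ne_of_lt_c (c := k - 2 - w') (by omega) (by omega) e.symm
    · exact f3r_ne_of_lt_c (c := k - 2 - w) (by omega) (by omega) e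
  rfl

open Classical in
/-- The four sub-families are pairwise disjoint. [cite: EntingJensen2009, §7.4.2, Fig. 7.10] -/
theorem disjoint_slackTwo_families {k : ℕ} (hk : 2 ≤ k) :
    Disjoint (f2aBlocks k) (f2bcBlocks k) ∧ Disjoint (f2aBlocks k ∪ f2bcBlocks k) (f3lBlocks k) ∧
      Disjoint (f2aBlocks k ∪ f2bcBlocks k ∪ f3lBlocks k) (f3rBlocks k) := by
  have d1 : Disjoint (f2aBlocks k) (f2bcBlocks k) := by
    refine disjoint_left.2 fun ω h1 h2 => ?_
    simp only [f2aBlocks, f2bcBlocks, mem_image, mem_range] at h1 h2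
    obtain ⟨a, ha, rfl⟩ := h1
    obtain ⟨j, hj, e⟩ := h2
    exact f2a_ne_f2bc (by omega) (by omega) e.symm
  have d2 : Disjoint (f2aBlocks k) (f3lBlocks k) := by
    refine disjoint_left.2 fun ω h1 h2 => ?_
    simp only [f2aBlocks, f3lBlocks, f3lIdx, mem_image, mem_range, mem_sigma, mem_product, mem_Icc] at h1 h2
    obtain ⟨a, ha, rfl⟩ := h1
    obtain ⟨⟨w, a', b'⟩, hp, e⟩ := h2
    exact f2a_ne_f3l (by omega) (by omega) e.symm
  have d3 : Disjoint (f2bcBlocks k) (f3lBlocks k) := by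
    refine disjoint_left.2 fun ω h1 h2 => ?_
    simp only [f2bcBlocks, f3lBlocks, f3lIdx, mem_image, mem_range, mem_sigma, mem_product, mem_Icc] at h1 h2
    obtain ⟨j, hj, rfl⟩ := h1
    obtain ⟨⟨w, a', b'⟩, hp, e⟩ := h2
    exact f3l_ne_f2bc (by omega) (by omega) e
  have d4 : Disjoint (f2aBlocks k) (f3rBlocks k) := by
    refine disjoint_left.2 fun ω h1 h2 => ?_
    simp only [f2aBlocks, f3rBlocks, f3rIdx, mem_image, mem_range, mem_sigma] at h1 h2
    obtain ⟨a, ha, rfl⟩ := h1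
    obtain ⟨⟨w, b'⟩, hp, e⟩ := h2
    exact f2a_ne_f3r (by omega) e.symm
  have d5 : Disjoint (f2bcBlocks k) (f3rBlocks k) := by
    refine disjoint_left.2 fun ω h1 h2 => ?_
    simp only [f2bcBlocks, f3rBlocks, f3rIdx, mem_image, mem_range, mem_sigma] at h1 h2
    obtain ⟨j, hj, rfl⟩ := h1
    obtain ⟨⟨w, b'⟩, hp, e⟩ := h2
    exact f3r_ne_f2bc (by omega) e
  have d6 : Disjoint (f3lBlocks k) (f3rBlocks k) := by
    refine disjoint_left.2 fun ω h1 h2 => ?_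
    simp only [f3lBlocks, f3lIdx, f3rBlocks, f3rIdx, mem_image, mem_range, mem_sigma, mem_product, mem_Icc] at h1 h2
    obtain ⟨⟨w, a, b⟩, hp, rfl⟩ := h1
    obtain ⟨⟨w', b'⟩, hp', e⟩ := h2
    exact f3l_ne_f3r (by omega) (by omega) e.symm
  exact ⟨d1, disjoint_union_left.2 ⟨d2, d3⟩, disjoint_union_left.2 ⟨disjoint_union_left.2 ⟨d4, d5⟩, d6⟩⟩

/-- The counting identity behind the census value: `(k−1) + 2 + Σ_{w<k−1} w(w+1) + Σ_{w<k−2} (w+1) = 2 + Σ_{j<k} j²`,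
written with `k = i + 2`. [folklore] -/
private theorem slackTwo_count (i : ℕ) :
    (i + 1) + 2 + ∑ w ∈ range (i + 1), w * (w + 1) + ∑ w ∈ range i, (w + 1) = 2 + ∑ j ∈ range (i + 2), j ^ 2 := by
  induction i with
  | zero => simp [sum_range_succ]
  | succ i ih =>
    simp only [sum_range_succ] at ih ⊢
    linear_combination ih

/-- `6 · Σ_{j<k} j² = (k−1)k(2k−1)`: the closed form of the census value `2 + Σ_{j<k} j² = 2 + (k−1)k(2k−1)/6`. [folklore] -/
private theorem six_mul_sum_range_sq (k : ℕ) : 6 * ∑ j ∈ range k, j ^ 2 = (k - 1) * k * (2 * k - 1) := by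
  induction k with
  | zero => simp
  | succ k ih =>
    rw [sum_range_succ, mul_add, ih]
    rcases k with _ | k
    · simp
    · simp only [Nat.add_sub_cancel, show 2 * (k + 1 + 1) - 1 = 2 * k + 3 by omega, show 2 * (k + 1) - 1 = 2 * k + 1 by omega]
      ring

open Classical in
/-- ★★ **The slack-two Finset has `2 + Σ_{j<k} j²` elements** (`k ≥ 2`), i.e. `2 + (k−1)k(2k−1)/6`: `3, 7, 16, 32, 57, …`.
[cite: EntingJensen2009, §7.4.2, Fig. 7.10] [cite: MadrasSlade1993, §4.2, Definition 4.2.1] -/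
theorem card_slackTwoBlocks {k : ℕ} (hk : 2 ≤ k) : #(slackTwoBlocks k) = 2 + ∑ j ∈ range k, j ^ 2 := by
  obtain ⟨d1, d2, d3⟩ := disjoint_slackTwo_families hk
  rw [slackTwoBlocks, card_union_of_disjoint d3, card_union_of_disjoint d2, card_union_of_disjoint d1, card_f2aBlocks,
    card_f2bcBlocks hk, card_f3lBlocks, card_f3rBlocks]
  obtain ⟨i, rfl⟩ : ∃ i, k = i + 2 := ⟨k - 2, by omega⟩
  rw [show i + 2 - 1 = i + 1 by omega, show i + 2 - 2 = i by omega]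
  exact slackTwo_count i

open Classical in
/-- ★★ **Every element of the slack-two Finset is an irreducible positive wall bridge of length `6k + 2` with exactly `k`
visits** (`k ≥ 2`, length symbolic). [cite: MadrasSlade1993, §4.2, Definition 4.2.1] [cite: Kesten1963SAW, §4]
[cite: BeatonBousquetMelouDeGierDuminilCopinGuttmann2014, §3.1 (arXiv v5 p. 8)] -/
theorem slackTwoBlocks_subset {k m : ℕ} (hk : 2 ≤ k) (hm : m = 6 * k + 2) :
    slackTwoBlocks k ⊆ (ipwb m).filter fun ω => visits m ω = k := by
  intro ω hω
  rw [mem_filter]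
  simp only [slackTwoBlocks, f2aBlocks, f2bcBlocks, f3lBlocks, f3lIdx, f3rBlocks, f3rIdx, mem_union, mem_image, mem_range,
    mem_sigma, mem_product, mem_Icc] at hω
  rcases hω with ((⟨a, ha, rfl⟩ | ⟨j, hj, rfl⟩) | ⟨⟨w, a, b⟩, hp, rfl⟩) | ⟨⟨w, b⟩, hp, rfl⟩
  · exact ⟨f2a_mem_ipwb (by omega) (by omega) hm, visits_f2a (by omega) (by omega) hm⟩
  · exact ⟨f2bc_mem_ipwb hk (by omega) hm, visits_f2bc hk (by omega) hm⟩
  · exact ⟨f3l_mem_ipwb (by omega) (by omega) (by omega) (by omega) hm,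
      visits_f3l (by omega) (by omega) (by omega) (by omega) hm⟩
  · exact ⟨f3r_mem_ipwb (by omega) (by omega) hm, visits_f3r (by omega) (by omega) hm⟩

/-! ### §7  The census lower bound `N_{3k+1,k} ≥ 2 + (k−1)k(2k−1)/6` -/

open Classical in
/-- ★★★ **Slack-two lower bound**: for every `k ≥ 2` there are at least `2 + Σ_{j<k} j² = 2 + (k−1)k(2k−1)/6` irreducible
positive wall bridges of length `6k + 2` with exactly `k` visits (symbolic length) — the F2a/F2b/F2c/F3L/F3R blocks.  Data
(lane enumeration, `k ≤ 5`): `N_{7,2} = 3`, `N_{10,3} = 7`, `N_{13,4} = 16`, `N_{16,5} = 32`, i.e. equality; equality for all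
`k` (the slack-two RIGIDITY) is not claimed here. [cite: MadrasSlade1993, §4.2, Definition 4.2.1, (4.2.2)] [cite: Kesten1963SAW, §4]
[cite: EntingJensen2009, §7.4.2, Fig. 7.10] -/
theorem two_add_sum_sq_le_card_filter_visits {k m : ℕ} (hk : 2 ≤ k) (hm : m = 6 * k + 2) :
    2 + ∑ j ∈ range k, j ^ 2 ≤ #((ipwb m).filter fun ω => visits m ω = k) := by
  rw [← card_slackTwoBlocks hk]
  exact card_le_card (slackTwoBlocks_subset hk hm)

open Classical in
/-- The same bound in closed form: `12 + (k−1)k(2k−1) ≤ 6 · N_{3k+1,k}`. [cite: MadrasSlade1993, §4.2, Definition 4.2.1, (4.2.2)] -/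
theorem closed_form_le_six_mul_card_filter_visits {k m : ℕ} (hk : 2 ≤ k) (hm : m = 6 * k + 2) :
    12 + (k - 1) * k * (2 * k - 1) ≤ 6 * #((ipwb m).filter fun ω => visits m ω = k) := by
  have h := Nat.mul_le_mul_left 6 (two_add_sum_sq_le_card_filter_visits hk hm)
  rw [mul_add, six_mul_sum_range_sq] at h
  exact h


end Literature.Probability.RandomPlanarGeometry.SAW.HexBW.Wall
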